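import Summits.CriticalPhenomena.PercolationContinuityZ3.Theorems.TallClusterMassBound.Negative.MassExponentFamily
import Literature.Probability.Percolation.AnchoredProfileVanishingLowDim

/-!
# `TallClusterMassBound` (stmt-CriticalPhenomena-0912), line `replica-overlap-cs-transfer`:
# the wall-arm regularity stub needs a POSITIVE exponent; `π_{p_c}(n) → 0`

Negative-side support (drefute) for the registered stub `stub_wallArmLowerRegularity` of the skeleton
`Cruxes/TallClusterMassBound/Lines/replica-overlap-cs-transfer.lean`:

  `∃ C lam : ℝ, lam < 11/4 ∧ ∀ n r : ℕ, 1 ≤ n → n ≤ r → π(n) ≤ C (r/n)^lam π(r)`,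
  `π(n) = armProb (criticalProbI 3) n = P_{p_c}(arm_ℍ(0,n))`.

* `armProb_succ_le_real_exitBox` : `π_p(m+1) ≤ P_p(C_ℍ(0) leaves B_m)` (the Cerf–Dembin exit event);
* `armProb_tendsto_zero_of_theta_halfSpace`, `armProb_criticalProbI_tendsto_zero` : `θ_ℍ(p) = 0 ⇒ π_p(n) → 0`,
  in particular at `p_c(ℤ³)` by the tree's Barsky–Grimmett–Newman theorem `BarskyGrimmettNewman1991_Z3_holds`
  (the QUALITATIVE shadow of crux C `QuantitativeBGN`, in the route's `arm` vocabulary);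
* `wallArmLowerRegularity_false_of_nonpos` : the stub's inequality with ANY exponent `lam ≤ 0` (and any `C`)
  is false at `p_c` — so every witness of the stub has `0 < lam < 11/4` (`wallArmLowerRegularity_exponent_pos`):
  the stub is not closable by monotonicity/constants alone, it is a genuine power-law LOWER-regularity statement;
* `not_wallArmLowerRegularity_nonpos` : the refuted sub-family, in the stub's `∃` shape.

Nothing here asserts a Theses statement.
-/

noncomputable section

open MeasureTheory Filter Topology
open Literature.Probability.Percolation Literature.Probability.LatticeModels

namespace Summit.CriticalPhenomena.PercolationContinuityZ3.Theorems.TallClusterMassBound.Negative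

/-- Almost surely, `arm_ℍ(0, m+1)` implies that the half-space cluster of `0` (lattice steps inside `ℍ`)
leaves the box `B_m`. [folklore] -/
theorem measure_arm_succ_le_exitBox (p : unitInterval) (m : ℕ) :
    Pp p (arm (m + 1)) ≤
      Pp p {ω | ∃ y ∈ openClusterIn (withinGraph (zdGraph 3) (halfSpace 3)) ω 0, y ∉ box 3 m} := by
  refine measure_mono_ae ?_
  filter_upwards [ae_subset_edgeSet p] with ω hω hωarm
  obtain ⟨y, hy, hreach⟩ := mem_arm_iff.1 hωarm
  refine ⟨y, ?_, ?_⟩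
  · rw [openClusterIn_withinGraph_eq_top (zdGraph 3) (halfSpace 3) hω]
    exact mem_openClusterIn_iff.2 hreach
  · intro hyb
    have := mem_box_iff_snorm.1 hyb
    omega

/-- `π_p(m+1) ≤ P_p(C_ℍ(0) leaves B_m)`. [folklore] -/
theorem armProb_succ_le_real_exitBox (p : unitInterval) (m : ℕ) :
    armProb p (m + 1) ≤
      (bondPercolation (zdGraph 3) p).real
        {ω | ∃ y ∈ openClusterIn (withinGraph (zdGraph 3) (halfSpace 3)) ω 0, y ∉ box 3 m} := by
  rw [armProb, measureReal_def, measureReal_def]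
  exact ENNReal.toReal_mono (measure_ne_top _ _) (measure_arm_succ_le_exitBox p m)

/-- **No percolation in `ℍ` ⇒ the wall-arm probabilities vanish**: `θ_ℍ(p) = 0 ⇒ π_p(n) → 0`
(continuity from above, via the tree's Cerf–Dembin exit lemma `CerfDembin.tendsto_real_exitBox`). [folklore] -/
theorem armProb_tendsto_zero_of_theta_halfSpace (p : unitInterval)
    (hθ : theta (halfSpaceGraph 3) (halfSpaceOrigin 3) p = 0) :
    Tendsto (fun n : ℕ => armProb p n) atTop (𝓝 0) := by
  have hD := CerfDembin.tendsto_real_exitBox 2 p hθ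
  have h1 : Tendsto (fun m : ℕ => armProb p (m + 1)) atTop (𝓝 0) :=
    tendsto_of_tendsto_of_tendsto_of_le_of_le tendsto_const_nhds hD
      (fun m => armProb_nonneg p (m + 1)) (fun m => armProb_succ_le_real_exitBox p m)
  exact (tendsto_add_atTop_iff_nat 1).1 h1

/-- **At `p_c(ℤ³)` the wall-arm probabilities vanish**: `π_{p_c}(n) → 0` (Barsky–Grimmett–Newman,
tree theorem `BarskyGrimmettNewman1991_Z3_holds`). The qualitative shadow of crux C. [folklore] -/
theorem armProb_criticalProbI_tendsto_zero :
    Tendsto (fun n : ℕ => armProb (criticalProbI 3) n) atTop (𝓝 0) :=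
  armProb_tendsto_zero_of_theta_halfSpace (criticalProbI 3) BarskyGrimmettNewman1991_Z3_holds

/-- **The regularity stub needs a positive exponent.** The inequality of `stub_wallArmLowerRegularity`
with an exponent `lam ≤ 0` is false at `p_c(ℤ³)` for every constant `C`: at `n = 1` it gives
`0 < π(1) ≤ |C| π(r) → 0`. [folklore] -/
theorem wallArmLowerRegularity_false_of_nonpos {C lam : ℝ} (hlam : lam ≤ 0)
    (h : ∀ n r : ℕ, 1 ≤ n → n ≤ r →
      armProb (criticalProbI 3) n ≤ C * ((r : ℝ) / n) ^ lam * armProb (criticalProbI 3) r) :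
    False := by
  have hπ1 := armProb_criticalProbI_pos 1
  have hbound : ∀ r : ℕ, 1 ≤ r → armProb (criticalProbI 3) 1 ≤ |C| * armProb (criticalProbI 3) r := by
    intro r hr
    have h1 := h 1 r le_rfl hr
    have hr' : (1 : ℝ) ≤ (r : ℝ) := by exact_mod_cast hr
    have hpow : ((r : ℝ) / (1 : ℕ)) ^ lam ≤ 1 := by
      rw [Nat.cast_one, div_one]
      exact Real.rpow_le_one_of_one_le_of_nonpos hr' hlam
    have hpow0 : 0 ≤ ((r : ℝ) / (1 : ℕ)) ^ lam := by positivity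
    have hπr := armProb_nonneg (criticalProbI 3) r
    calc armProb (criticalProbI 3) 1 ≤ C * ((r : ℝ) / (1 : ℕ)) ^ lam * armProb (criticalProbI 3) r := h1
      _ ≤ |C| * ((r : ℝ) / (1 : ℕ)) ^ lam * armProb (criticalProbI 3) r := by
          gcongr
          exact le_abs_self C
      _ ≤ |C| * 1 * armProb (criticalProbI 3) r := by
          gcongr
      _ = |C| * armProb (criticalProbI 3) r := by ring
  have hlim : Tendsto (fun r : ℕ => |C| * armProb (criticalProbI 3) r) atTop (𝓝 (|C| * 0)) :=
    armProb_criticalProbI_tendsto_zero.const_mul |C|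
  rw [mul_zero] at hlim
  have hle : armProb (criticalProbI 3) 1 ≤ 0 :=
    ge_of_tendsto hlim (Filter.eventually_atTop.2 ⟨1, fun r hr => hbound r hr⟩)
  linarith

/-- Hence every witness `(C, lam)` of `stub_wallArmLowerRegularity` has `0 < lam` (and `lam < 11/4`):
the stub is a genuine power-law statement, `π(r) ≥ C⁻¹ (n/r)^lam π(n)` with `lam ∈ (0, 11/4)`. [folklore] -/
theorem wallArmLowerRegularity_exponent_pos {C lam : ℝ}
    (h : ∀ n r : ℕ, 1 ≤ n → n ≤ r →
      armProb (criticalProbI 3) n ≤ C * ((r : ℝ) / n) ^ lam * armProb (criticalProbI 3) r) :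
    0 < lam :=
  lt_of_not_ge fun hle => wallArmLowerRegularity_false_of_nonpos hle h

/-- REFUTED SUB-FAMILY of the stub (natural 'strengthening' by a non-positive exponent):
`¬ ∃ C, ∃ lam ≤ 0, ∀ 1 ≤ n ≤ r, π(n) ≤ C (r/n)^lam π(r)` at `p_c(ℤ³)`. [folklore] -/
theorem not_wallArmLowerRegularity_nonpos :
    ¬ ∃ C lam : ℝ, lam ≤ 0 ∧ ∀ n r : ℕ, 1 ≤ n → n ≤ r →
      armProb (criticalProbI 3) n ≤ C * ((r : ℝ) / n) ^ lam * armProb (criticalProbI 3) r :=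
  fun ⟨_, _, hlam, h⟩ => wallArmLowerRegularity_false_of_nonpos hlam h

end Summit.CriticalPhenomena.PercolationContinuityZ3.Theorems.TallClusterMassBound.Negative
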